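import Summits.ValiantsHypothesis.ValiantsHypothesis.Theorems.LacunarySymmetroidMatrixDescartesCensusV19SSoundFarkas

/-!
# `MatrixDescartes` census — soundness of the 2-SIDON `V = 19` checker: no model passes an accepted certificate (`V19S.certOK_sound`)

HONEST FRAMING.  Object-search cell `pub-symmetroid`; door-A item `DoorA26 = PosRootLawAt 2 6 19`
(stmt-ValiantsHypothesis-19979; OPEN, typed, never asserted).  Conclusion of the abstract soundness layer of `…CensusV19SCheck` (semantics
`…CensusV19SModel`): single-monomial domination, odd definite triangles, odd triangles through a null letter, all-negative inequalities and
Farkas combinations (`…CensusV19SSoundFarkas`) refute a model (twin of `…CensusV19CSoundCerts`); and the middle-window DISJUNCTION: a model of a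
mode-`A` cell is a model of one of the two branches (`V19S.Model.branch`), so a `branch2` certificate — one accepted leaf per branch — refutes it.
Nothing here bears on the one-collision supports, on `ζ_sym(2,6)` over all supports, on `DoorA26` itself, on `MatrixDescartes`
(stmt-ValiantsHypothesis-18050) or on `VP ≠ VNP`.

[folklore] Certificate-checker soundness; elementary.
-/

-- the D-0017 layout repeats a namespace component (single-conjunct summit); the `dupNamespace` linter flags it; name mandated.
set_option linter.dupNamespace false

namespace Summit.ValiantsHypothesis.ValiantsHypothesis.Theorems.LacunarySymmetroidMatrixDescartes.Census.V19S

open V20 (Atom allAtoms psum posOf qA cA Term PolySpec posl oddTrues FNat fval Row FRat negAt G3poly RCSpoly Wpoly tval pval lprod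
  lprod_pos atoms_valid coeff_ne_zero qA_mem cA_mem term_getD_mem pval_eq_sum_range)
open V19C (sum_map_eq_sum_map_filter sum_neg_of_forall_neg)

section Certs

open Finset

variable {c : Ctx} {x : ℕ → ℝ} {v : Atom → ℝ}

/-! ### Domination certificates -/

/-- An accepted domination certificate refutes the model. [folklore] -/
theorem domOK_sound (M : V19S.Model c x v) {P : PolySpec} {n0 ud : ℕ} {comps : List Comp}
    (h : domOK c P n0 ud comps = true) : False := by
  classical
  unfold domOK at h
  simp only [Bool.and_eq_true, decide_eq_true_eq, List.all_eq_true, Bool.not_eq_true'] at h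
  obtain ⟨⟨⟨⟨⟨⟨⟨⟨⟨⟨hval, hdef⟩, hn0⟩, hz0⟩, hneg⟩, hud⟩, hcov⟩, hpos⟩, hnd⟩, hsum⟩, hall⟩ := h
  have hP : 0 ≤ pval v P.poly := by
    refine pval_nonneg M P hval fun i j hij => ?_
    subst hij; simpa [defOK] using hdef
  set w : ℕ → ℝ := fun n => tval v (P.poly.getD n (0, [])) with hw
  have hT0a := atoms_valid P hval _ (term_getD_mem P.poly hn0)
  have hg0 : (P.poly.getD n0 (0, [])).1 ≠ 0 := coeff_ne_zero P _ (term_getD_mem P.poly hn0)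
  have hw0 : 0 < |w n0| := by
    rw [hw]; simp only
    rw [abs_tval_eq M _ hT0a hz0]
    exact mul_pos (abs_pos.2 (by exact_mod_cast hg0)) (lprod_pos M.xpos _)
  have hklt : ∀ cp ∈ comps, cp.k < P.poly.length := fun cp hcp => lt_length_of_mem_posTerms (hpos cp hcp)
  have hkz : ∀ cp ∈ comps, termZero c (P.poly.getD cp.k (0, [])) = false := fun cp hcp =>
    ((mem_posTerms_iff (hklt cp hcp)).1 (hpos cp hcp)).1
  have hbounds : (comps.map fun cp => |w cp.k| * ud).sum ≤ (comps.map fun cp => (cp.un : ℝ) * |w n0|).sum :=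
    List.sum_le_sum fun cp hcp => compOK_sound M hval hn0 hz0 hud (hklt cp hcp) (hkz cp hcp) (hall cp hcp)
  have hsumR : ((comps.map Comp.un).sum : ℝ) < ud := by exact_mod_cast hsum
  have hlt : (comps.map fun cp => |w cp.k|).sum < |w n0| := by
    have e1 : (comps.map fun cp => |w cp.k| * ud).sum = (comps.map fun cp => |w cp.k|).sum * ud := by
      rw [List.sum_map_mul_right]
    have e2 : (comps.map fun cp => (cp.un : ℝ) * |w n0|).sum = ((comps.map Comp.un).sum : ℝ) * |w n0| := by
      push_cast
      rw [List.map_map, ← List.sum_map_mul_right]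
      rfl
    rw [e1, e2] at hbounds
    have hudR : (0 : ℝ) < ud := by exact_mod_cast hud
    nlinarith
  set posS := (posTerms c P.poly).toFinset with hposS
  have hposSub : posS ⊆ Finset.range P.poly.length := by
    intro n hn
    rw [hposS, List.mem_toFinset] at hn
    exact Finset.mem_range.2 (lt_length_of_mem_posTerms hn)
  have hrest : ∀ n ∈ Finset.range P.poly.length \ posS, w n ≤ 0 := by
    intro n hn
    rw [Finset.mem_sdiff, Finset.mem_range, hposS, List.mem_toFinset] at hn
    have hnp : ¬ (termZero c (P.poly.getD n (0, [])) = false ∧ termNeg c (P.poly.getD n (0, [])) = false) :=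
      fun hh => hn.2 ((mem_posTerms_iff hn.1).2 hh)
    exact tval_nonpos_of_not_pos M _ (atoms_valid P hval _ (term_getD_mem P.poly hn.1)) hnp
  have hn0rest : n0 ∈ Finset.range P.poly.length \ posS := by
    rw [Finset.mem_sdiff, Finset.mem_range, hposS, List.mem_toFinset]
    refine ⟨hn0, fun hmem => ?_⟩
    have := ((mem_posTerms_iff hn0).1 hmem).2
    rw [this] at hneg
    exact Bool.false_ne_true hneg
  have hsplit : pval v P.poly = ∑ n ∈ posS, w n + ∑ n ∈ Finset.range P.poly.length \ posS, w n := by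
    rw [pval_eq_sum_range, ← Finset.sum_sdiff hposSub, add_comm]
  have hrestle : ∑ n ∈ Finset.range P.poly.length \ posS, w n ≤ w n0 := by
    rw [← Finset.add_sum_erase _ _ hn0rest]
    have : ∑ n ∈ (Finset.range P.poly.length \ posS).erase n0, w n ≤ 0 :=
      Finset.sum_nonpos fun n hn => hrest n (Finset.mem_of_mem_erase hn)
    linarith
  have hposle : ∑ n ∈ posS, w n ≤ (comps.map fun cp => |w cp.k|).sum := by
    have hsub2 : posS ⊆ (comps.map Comp.k).toFinset := by
      intro n hn
      rw [hposS, List.mem_toFinset] at hn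
      obtain ⟨cp, hcp, hck⟩ := hcov n hn
      rw [List.mem_toFinset, List.mem_map]
      exact ⟨cp, hcp, hck⟩
    calc ∑ n ∈ posS, w n ≤ ∑ n ∈ posS, |w n| := Finset.sum_le_sum fun n _ => le_abs_self _
      _ ≤ ∑ n ∈ (comps.map Comp.k).toFinset, |w n| :=
          Finset.sum_le_sum_of_subset_of_nonneg hsub2 fun n _ _ => abs_nonneg _
      _ = ((comps.map Comp.k).map fun n => |w n|).sum := List.sum_toFinset _ hnd
      _ = (comps.map fun cp => |w cp.k|).sum := by rw [List.map_map]; rfl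
  have hw0le : w n0 ≤ 0 := hrest n0 hn0rest
  have : |w n0| = -w n0 := abs_of_nonpos hw0le
  linarith

/-! ### Sign certificates -/

/-- Product of three signed non-zero atoms: parity sign times the (positive) product of slot magnitudes. [folklore] -/
theorem prod_three_eq (M : V19S.Model c x v) {a b e : Atom} (ha : a ∈ allAtoms) (hb : b ∈ allAtoms) (he : e ∈ allAtoms)
    (hza : atomZero c a = false) (hzb : atomZero c b = false) (hze : atomZero c e = false) :
    v a * v b * v e = (if oddTrues [negSlot c.s c.mode (c.slot a), negSlot c.s c.mode (c.slot b),
        negSlot c.s c.mode (c.slot e)] then -1 else 1) * (x (c.slot a) * x (c.slot b) * x (c.slot e)) := by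
  have hprod := prod_map_sgR_mul c x [a, b, e] (by
    intro d hd
    simp only [List.mem_cons, List.not_mem_nil, or_false] at hd
    rcases hd with rfl | rfl | rfl
    · simpa [atomZero] using hza
    · simpa [atomZero] using hzb
    · simpa [atomZero] using hze)
  simp only [List.map_cons, List.map_nil, List.prod_cons, List.prod_nil, mul_one, lprod] at hprod
  rw [← M.hv a ha, ← M.hv b hb, ← M.hv e he] at hprod
  rw [← mul_assoc] at hprod
  rw [hprod]; ring

/-- An accepted odd definite triangle refutes the model. [folklore] -/
theorem signOK_sound (M : V19S.Model c x v) {i j k : ℕ} (h : signOK c i j k = true) : False := by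
  unfold signOK at h
  simp only [Bool.and_eq_true, decide_eq_true_eq, Bool.not_eq_true'] at h
  obtain ⟨⟨⟨⟨⟨⟨⟨⟨hij, hjk, hk6⟩, hi⟩, hj⟩, hk⟩, hzij⟩, hzjk⟩, hzik⟩, hodd⟩ := h
  have hi6 : i < 6 := by omega
  have hj6 : j < 6 := by omega
  have htri := M.tri i j k hij hjk hk6 (M.v_pos (qA_mem hi6) hi) (M.v_pos (qA_mem hj6) hj) (M.v_pos (qA_mem hk6) hk)
  rw [prod_three_eq M (cA_mem hi6 hj6) (cA_mem hj6 hk6) (cA_mem hi6 hk6) hzij hzjk hzik, hodd] at htri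
  simp only [ite_true] at htri
  have h1 := M.xpos (c.slot (cA i j))
  have h2 := M.xpos (c.slot (cA j k))
  have h3 := M.xpos (c.slot (cA i k))
  have : 0 < x (c.slot (cA i j)) * x (c.slot (cA j k)) * x (c.slot (cA i k)) := by positivity
  linarith

/-- An accepted odd triangle through a null letter refutes the model. [folklore] -/
theorem signNullOK_sound (M : V19S.Model c x v) {n a b : ℕ} (h : signNullOK c n a b = true) : False := by
  unfold signNullOK at h
  simp only [Bool.and_eq_true, decide_eq_true_eq, Bool.not_eq_true'] at h
  obtain ⟨⟨⟨⟨⟨⟨⟨⟨hn6, hab, hb6, hna, hnb⟩, hzn⟩, ha⟩, hb⟩, hzna⟩, hzab⟩, hznb⟩, hodd⟩ := h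
  have ha6 : a < 6 := by omega
  have htri := M.triNull n a b hn6 hab hb6 hna hnb (M.v_eq_zero (qA_mem hn6) hzn) (M.v_pos (qA_mem ha6) ha)
    (M.v_pos (qA_mem hb6) hb) (M.v_ne_zero (cA_mem hn6 hb6) hznb)
  rw [prod_three_eq M (cA_mem hn6 ha6) (cA_mem ha6 hb6) (cA_mem hn6 hb6) hzna hzab hznb, hodd] at htri
  simp only [ite_true] at htri
  have h1 := M.xpos (c.slot (cA n a))
  have h2 := M.xpos (c.slot (cA a b))
  have h3 := M.xpos (c.slot (cA n b))
  have : 0 < x (c.slot (cA n a)) * x (c.slot (cA a b)) * x (c.slot (cA n b)) := by positivity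
  linarith

/-! ### All-negative certificates -/

/-- An accepted all-negative certificate refutes the model. [folklore] -/
theorem allnegOK_sound (M : V19S.Model c x v) {P : PolySpec} (h : allnegOK c P = true) : False := by
  unfold allnegOK at h
  simp only [Bool.and_eq_true, decide_eq_true_eq, List.all_eq_true] at h
  obtain ⟨⟨⟨hval, hdef⟩, hne⟩, hneg⟩ := h
  have hP : 0 ≤ pval v P.poly := by
    refine pval_nonneg M P hval fun i j hij => ?_
    subst hij; simpa [defOK] using hdef
  have hsplit := sum_map_eq_sum_map_filter (tval v) (fun T => !termZero c T) P.poly (fun T hT hq => by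
    have hz : termZero c T = true := by simpa using hq
    exact tval_eq_zero_of_termZero M T (atoms_valid P hval T hT) hz)
  have hlt : ((P.poly.filter fun T => !termZero c T).map (tval v)).sum < 0 := by
    refine sum_neg_of_forall_neg _ (by simpa using hne) fun a ha => ?_
    rw [List.mem_map] at ha
    obtain ⟨T, hT, rfl⟩ := ha
    rw [List.mem_filter] at hT
    have hz : termZero c T = false := by simpa using hT.2
    exact tval_neg_of_termNeg M T (atoms_valid P hval T hT.1) hz (hneg T (List.mem_filter.2 hT)) (coeff_ne_zero P T hT.1)
  unfold pval at hP
  rw [hsplit] at hP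
  linarith

/-- **Soundness of the leaf certificates (abstract form)**: no model passes an accepted leaf certificate. [folklore] -/
theorem cert0OK_sound (M : V19S.Model c x v) {ct : Cert0} (h : cert0OK c ct = true) : False := by
  cases ct with
  | sign i j k => exact signOK_sound M h
  | signNull n a b => exact signNullOK_sound M h
  | allneg P => exact allnegOK_sound M h
  | lp rows => exact lpOK_sound M h
  | dom P n0 ud comps => exact domOK_sound M h

/-! ### The middle-window disjunction -/

/-- A model of a mode-`A k` cell with a middle window is a model of one of the two branches: at the balance point, one of the two
middle terms is the larger. [folklore] -/
theorem Model.branch (M : V19S.Model c x v) {k : ℕ} (hk : c.mode = .A k) (h1 : 1 ≤ k) (h2 : k + 2 ≤ 20) :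
    Model { c with mid := some k } x v ∨ Model { c with mid := some (k + 1) } x v := by
  obtain ⟨y, hy, hbal, -, -⟩ := M.winMid k hk h1 h2
  rcases le_total (wterm c x (k - 1) (k + 1) y) (wterm c x (k - 1) k y) with hle | hle
  · left
    exact
      { wf := ⟨M.wf.hord, M.wf.hE, M.wf.hmode⟩, xpos := M.xpos, hv := M.hv, c25A := M.c25A, c25B := M.c25B,
        winLow := M.winLow, winHigh := M.winHigh,
        winMid := fun k' hk' _ _ => by
          have hkk : k' = k := by
            have : Mode.A k = Mode.A k' := hk.symm.trans hk'
            cases this; rfl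
          subst hkk
          refine ⟨y, hy, hbal, fun _ => hle, fun habs => ?_⟩
          simp only [Option.some.injEq] at habs
          omega
        g3 := M.g3, rcs := M.rcs, w := M.w, tri := M.tri, triNull := M.triNull }
  · right
    exact
      { wf := ⟨M.wf.hord, M.wf.hE, M.wf.hmode⟩, xpos := M.xpos, hv := M.hv, c25A := M.c25A, c25B := M.c25B,
        winLow := M.winLow, winHigh := M.winHigh,
        winMid := fun k' hk' _ _ => by
          have hkk : k' = k := by
            have : Mode.A k = Mode.A k' := hk.symm.trans hk'
            cases this; rfl
          subst hkk
          refine ⟨y, hy, hbal, fun habs => ?_, fun _ => hle⟩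
          simp only [Option.some.injEq] at habs
          omega
        g3 := M.g3, rcs := M.rcs, w := M.w, tri := M.tri, triNull := M.triNull }

/-- **Soundness of the 2-Sidon certificate checker (abstract form)**: no model passes an accepted certificate — a leaf directly, a
`branch2` through the branch the model falls in. [folklore] -/
theorem certOK_sound (M : V19S.Model c x v) {ct : Cert} (h : certOK c ct = true) : False := by
  cases ct with
  | leaf ct => exact cert0OK_sound M h
  | branch2 cK cK1 =>
    obtain ⟨d, ord, E, s, mode, mid⟩ := c
    cases mode with
    | B z => simp [certOK] at h
    | A k =>
      simp only [certOK, Bool.and_eq_true, decide_eq_true_eq] at h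
      obtain ⟨⟨⟨h1, h2⟩, hK⟩, hK1⟩ := h
      rcases M.branch rfl h1 h2 with M' | M'
      · exact cert0OK_sound M' hK
      · exact cert0OK_sound M' hK1

end Certs

end Summit.ValiantsHypothesis.ValiantsHypothesis.Theorems.LacunarySymmetroidMatrixDescartes.Census.V19S
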